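import Summits.CriticalPhenomena.PercolationContinuityZ3.Theorems.PercNearOneGluingNoHeavyLowerTailThreePartitionVOrder

/-!
# `NoHeavyLowerTail` (crux stmt-CriticalPhenomena-4575): CONJECTURE V holds for NESTED pairs —
# the three-partition kernel of `E₃` is up-set-nonnegative on the face poset of the cube whenever `𝒱 ⊆ 𝒲`,
# by three applications of the fibrewise four functions theorem ("Kleitman twice" = Theorem U)

Support file (lineage `prim-bnk-2`, generation 24; `--supports stmt-CriticalPhenomena-4575`; memo
`run/shared/lean/prim/prim-l12/FROM-prim-bnk-2-g24-NESTED-V.md`).  No `sorry`, standard axioms, nothing conditional.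

Recall (`…ThreePartitionVOrder`): for up-sets `𝒱, 𝒲 ⊆ 𝒫(ι)`, a twist `τ` and a family `𝒳` of pairs that is an up-set of the
COPY ORDER (product order on `Set ι × Set ι`), `vSumT τ 𝒱 𝒲 𝒳` is the sum over the ordered 3-partitions `(S₁,S₂,S₃)`
(copies `a = S₁ ∆ τ, b = S₂ ∆ τ, c = S₃ ∆ τ`) with `(a,b) ∈ 𝒳` of the kernel
`K(a,b,c) = 2[a∈𝒱][a∈𝒲] + [c∈𝒱][b∈𝒲] − [a∈𝒲][c∈𝒱] − [a∈𝒱][c∈𝒲] − [c∈𝒱][c∈𝒲]`,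
and Conjecture V (`VOrderPositivity`, OPEN) says `vSumT ≥ 0`; it implies Sahi's `C₃` on product measures.

**Theorem (this file).** `vSumT τ 𝒱 𝒲 𝒳 ≥ 0` whenever `𝒱 ⊆ 𝒲` (`vSumT_nonneg_of_subset`).  Consequently the twisted
three-partition functional is nonnegative on every triple of up-sets two of which are nested
(`threePartNT_nonneg_of_subset`, `threePartNT_nonneg_of_nested`; untwisted `threePartN_nonneg_of_nested`).

**Proof** ("two monotone moves").  Write `X(P)` for the number of 3-partitions with `(a,b) ∈ 𝒳` and `P`.  On a COLUMN
(spectator = part 2, so `b` is fixed and `c` is the reflection of `a` on the folding fibre `(S₂ᶜ, S₂ ∩ τ)`) the section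
`{a : (a,b) ∈ 𝒳}` is an up-set, so moving an increasing requirement from `c` to `a` can only increase a count
(`triT_col_le`, the tree's fibrewise Harris `FoldingFibre.fibreCount_le_of_isUpperSet`); on a FIBRE (spectator = part 1,
`a` fixed, `c` the reflection of `b`) moving a decreasing requirement from `b` to `c` can only increase a count
(`triT_fib_le`, `FoldingFibre.fibreCount_le_of_isUpperSet_isLowerSet`).  For `𝒱 ⊆ 𝒲`:
`X(a∈𝒲, c∈𝒱) ≤ X(a∈𝒱)` (column), and `X(c∈𝒱, b∉𝒲) ≤ X(a∈𝒱, b∉𝒲) ≤ X(a∈𝒱, c∉𝒲)` (column, then fibre — this two-step chain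
is the up-set form of generation 23's "Theorem U", there proved by a unimodular determinant); with the exact splittings
`X(a∈𝒱) = X(a∈𝒱, c∈𝒲) + X(a∈𝒱, c∉𝒲)` and `X(c∈𝒱) = X(c∈𝒱, b∈𝒲) + X(c∈𝒱, b∉𝒲)` this is `vSumT ≥ 0`. [this work]
-/

noncomputable section

open Finset
open scoped symmDiff Classical

namespace Summit.CriticalPhenomena.PercolationContinuityZ3.Theorems.ThreePartition

open Literature.Probability.Percolation

variable {ι : Type*} [Fintype ι]

/-! ## Bookkeeping for twisted counts -/

/-- Splitting a twisted count by an extra condition: `#(p ∧ q) + #(p ∧ ¬q) = #p`. [this work] -/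
theorem triT_and_add_triT_and_not (τ : Set ι) (p q : Set ι → Set ι → Set ι → Prop) :
    triT τ (fun a b c => p a b c ∧ q a b c) + triT τ (fun a b c => p a b c ∧ ¬ q a b c) = triT τ p := by
  simp only [triT, tri]
  have h1 : (univ.filter fun x : Set ι × Set ι =>
        Disjoint x.1 x.2 ∧ (p (x.1 ∆ τ) (x.2 ∆ τ) ((x.1 ∪ x.2)ᶜ ∆ τ) ∧ q (x.1 ∆ τ) (x.2 ∆ τ) ((x.1 ∪ x.2)ᶜ ∆ τ))) =
      (univ.filter fun x : Set ι × Set ι => Disjoint x.1 x.2 ∧ p (x.1 ∆ τ) (x.2 ∆ τ) ((x.1 ∪ x.2)ᶜ ∆ τ)).filter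
        fun x => q (x.1 ∆ τ) (x.2 ∆ τ) ((x.1 ∪ x.2)ᶜ ∆ τ) := by
    rw [filter_filter]; exact filter_congr fun x _ => by rw [and_assoc]
  have h2 : (univ.filter fun x : Set ι × Set ι =>
        Disjoint x.1 x.2 ∧ (p (x.1 ∆ τ) (x.2 ∆ τ) ((x.1 ∪ x.2)ᶜ ∆ τ) ∧ ¬ q (x.1 ∆ τ) (x.2 ∆ τ) ((x.1 ∪ x.2)ᶜ ∆ τ))) =
      (univ.filter fun x : Set ι × Set ι => Disjoint x.1 x.2 ∧ p (x.1 ∆ τ) (x.2 ∆ τ) ((x.1 ∪ x.2)ᶜ ∆ τ)).filter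
        fun x => ¬ q (x.1 ∆ τ) (x.2 ∆ τ) ((x.1 ∪ x.2)ᶜ ∆ τ) := by
    rw [filter_filter]; exact filter_congr fun x _ => by rw [and_assoc]
  rw [h1, h2, card_filter_add_card_filter_not]

/-- Swapping parts 1 and 2 does not change a twisted count. [this work] -/
theorem triT_swap12 (τ : Set ι) (p : Set ι → Set ι → Set ι → Prop) :
    triT τ p = triT τ (fun a b c => p b a c) := by
  unfold triT; rw [tri_swap12]

/-! ## The two monotone moves (fibrewise four functions theorem) -/

/-- **Column move.**  On a column (part 2 fixed) an increasing requirement may be moved from the third copy `c` to the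
first copy `a` without decreasing the count, provided the requirement already on `a` is increasing (it may depend on `b`):
`#{a ∈ 𝒜_b, c ∈ G} ≤ #{a ∈ 𝒜_b ∩ G}`.  (Fibrewise Harris on the folding fibre `(S₂ᶜ, S₂ ∩ τ)`.) [this work] -/
theorem triT_col_le (τ : Set ι) (𝒜 : Set ι → Set (Set ι)) (h𝒜 : ∀ b, IsUpperSet (𝒜 b)) {G : Set (Set ι)}
    (hG : IsUpperSet G) :
    triT τ (fun a b c => a ∈ 𝒜 b ∧ c ∈ G) ≤ triT τ (fun a b _ => a ∈ 𝒜 b ∧ a ∈ G) := by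
  rw [triT_eq_sum_snd, triT_eq_sum_snd]
  refine sum_le_sum fun S _ => ?_
  have h := FoldingFibre.fibreCount_le_of_isUpperSet (h𝒜 (S ∆ τ)) hG Sᶜ (S ∩ τ)
  refine le_trans (card_le_card fun x hx => ?_) (le_trans h (card_le_card fun x hx => ?_))
  · simp only [mem_filter, mem_univ, true_and] at hx ⊢
    exact hx
  · simp only [mem_filter, mem_univ, true_and, Set.mem_inter_iff, Set.mem_univ, and_true] at hx ⊢
    exact hx

/-- **Fibre move.**  On a fibre (part 1 fixed) a decreasing requirement may be moved from the second copy `b` to the third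
copy `c` without decreasing the count, provided the requirement already on `b` is increasing (it may depend on `a`):
`#{b ∈ ℬ_a ∩ D} ≤ #{b ∈ ℬ_a, c ∈ D}`.  (Fibrewise Harris, increasing/decreasing, on the fibre `(S₁ᶜ, S₁ ∩ τ)`.) [this work] -/
theorem triT_fib_le (τ : Set ι) (ℬ : Set ι → Set (Set ι)) (hℬ : ∀ a, IsUpperSet (ℬ a)) {D : Set (Set ι)}
    (hD : IsLowerSet D) :
    triT τ (fun a b _ => b ∈ ℬ a ∧ b ∈ D) ≤ triT τ (fun a b c => b ∈ ℬ a ∧ c ∈ D) := by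
  rw [triT_eq_sum_fst, triT_eq_sum_fst]
  refine sum_le_sum fun S _ => ?_
  have h := FoldingFibre.fibreCount_le_of_isUpperSet_isLowerSet (hℬ (S ∆ τ)) hD Sᶜ (S ∩ τ)
  refine le_trans (card_le_card fun x hx => ?_) (le_trans h (card_le_card fun x hx => ?_))
  · simp only [mem_filter, mem_univ, true_and, Set.mem_inter_iff, Set.mem_univ, and_true] at hx ⊢
    exact hx
  · simp only [mem_filter, mem_univ, true_and] at hx ⊢
    exact hx

/-- **Theorem U, up-set form** (generation 23's unimodular matching, here = column move + fibre move): for up-sets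
`G, H` and an up-set `𝒳` of the copy order, `#{(a,b)∈𝒳 : c ∈ G, b ∉ H} ≤ #{(a,b)∈𝒳 : a ∈ G, c ∉ H}`. [this work] -/
theorem triT_thmU_le (τ : Set ι) {𝒳 : Set (Set ι × Set ι)} (h𝒳 : IsUpperSet 𝒳) {G H : Set (Set ι)}
    (hG : IsUpperSet G) (hH : IsUpperSet H) :
    triT τ (fun a b c => (a, b) ∈ 𝒳 ∧ c ∈ G ∧ b ∉ H) ≤ triT τ (fun a b c => (a, b) ∈ 𝒳 ∧ a ∈ G ∧ c ∉ H) := by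
  -- column move: `c ∈ G` ↦ `a ∈ G` (the requirement `b ∉ H` rides on the spectator)
  have h1 : triT τ (fun a b c => (a, b) ∈ 𝒳 ∧ c ∈ G ∧ b ∉ H) ≤
      triT τ (fun a b _ => (a, b) ∈ 𝒳 ∧ a ∈ G ∧ b ∉ H) := by
    have hA : ∀ b : Set ι, IsUpperSet {a : Set ι | (a, b) ∈ 𝒳 ∧ b ∉ H} := fun b a a' hle ha =>
      ⟨h𝒳 (Prod.mk_le_mk.2 ⟨hle, le_rfl⟩) ha.1, ha.2⟩
    have h := triT_col_le τ (fun b => {a : Set ι | (a, b) ∈ 𝒳 ∧ b ∉ H}) hA hG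
    refine le_trans (le_of_eq (triT_congr fun a b c => ?_)) (le_trans h (le_of_eq (triT_congr fun a b c => ?_)))
    · simp only [Set.mem_setOf_eq]; tauto
    · simp only [Set.mem_setOf_eq]; tauto
  -- fibre move: `b ∉ H` ↦ `c ∉ H` (the requirement `a ∈ G` rides on the spectator)
  have h2 : triT τ (fun a b _ => (a, b) ∈ 𝒳 ∧ a ∈ G ∧ b ∉ H) ≤
      triT τ (fun a b c => (a, b) ∈ 𝒳 ∧ a ∈ G ∧ c ∉ H) := by
    have hB : ∀ a : Set ι, IsUpperSet {b : Set ι | (a, b) ∈ 𝒳 ∧ a ∈ G} := fun a b b' hle hb =>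
      ⟨h𝒳 (Prod.mk_le_mk.2 ⟨le_rfl, hle⟩) hb.1, hb.2⟩
    have hD : IsLowerSet {b : Set ι | b ∉ H} := fun b b' hle hb hb' => hb (hH hle hb')
    have h := triT_fib_le τ (fun a => {b : Set ι | (a, b) ∈ 𝒳 ∧ a ∈ G}) hB hD
    refine le_trans (le_of_eq (triT_congr fun a b c => ?_)) (le_trans h (le_of_eq (triT_congr fun a b c => ?_)))
    · simp only [Set.mem_setOf_eq]; tauto
    · simp only [Set.mem_setOf_eq]; tauto
  exact le_trans h1 h2

/-! ## Conjecture V for nested pairs -/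

/-- **CONJECTURE V HOLDS FOR NESTED PAIRS `𝒱 ⊆ 𝒲`** (all twists, all up-sets `𝒳` of the copy order): the kernel sum
`vSumT τ 𝒱 𝒲 𝒳` is `≥ 0`.  Proof: `K = T1 + L` with `T1 = [a∈𝒲]([a∈𝒱] − [c∈𝒱])` (one column move) and
`L = [a∈𝒱][c∉𝒲] − [c∈𝒱][b∉𝒲]` (Theorem U = column move + fibre move). [this work] -/
theorem vSumT_nonneg_of_subset (τ : Set ι) {𝒱 𝒲 : Set (Set ι)} {𝒳 : Set (Set ι × Set ι)}
    (h𝒱 : IsUpperSet 𝒱) (h𝒲 : IsUpperSet 𝒲) (h𝒳 : IsUpperSet 𝒳) (hsub : 𝒱 ⊆ 𝒲) :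
    0 ≤ vSumT τ 𝒱 𝒲 𝒳 := by
  -- the five counts, and the two auxiliary ones
  have e1 : triT τ (fun a b _ => (a, b) ∈ 𝒳 ∧ a ∈ 𝒱 ∧ a ∈ 𝒲) = triT τ (fun a b _ => (a, b) ∈ 𝒳 ∧ a ∈ 𝒱) :=
    triT_congr fun a b c => ⟨fun h => ⟨h.1, h.2.1⟩, fun h => ⟨h.1, h.2, hsub h.2⟩⟩
  have e5 : triT τ (fun a b c => (a, b) ∈ 𝒳 ∧ c ∈ 𝒱 ∧ c ∈ 𝒲) = triT τ (fun a b c => (a, b) ∈ 𝒳 ∧ c ∈ 𝒱) :=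
    triT_congr fun a b c => ⟨fun h => ⟨h.1, h.2.1⟩, fun h => ⟨h.1, h.2, hsub h.2⟩⟩
  -- `X(a∈𝒱) = X(a∈𝒱, c∈𝒲) + X(a∈𝒱, c∉𝒲)`
  have s1 := triT_and_add_triT_and_not τ (fun a b _ => (a, b) ∈ 𝒳 ∧ a ∈ 𝒱) (fun _ _ c => c ∈ 𝒲)
  -- `X(c∈𝒱) = X(c∈𝒱, b∈𝒲) + X(c∈𝒱, b∉𝒲)`
  have s5 := triT_and_add_triT_and_not τ (fun a b c => (a, b) ∈ 𝒳 ∧ c ∈ 𝒱) (fun _ b _ => b ∈ 𝒲)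
  -- column move: `X(a∈𝒲, c∈𝒱) ≤ X(a∈𝒲, a∈𝒱) = X(a ∈ 𝒱)`
  have h3 : triT τ (fun a b c => (a, b) ∈ 𝒳 ∧ a ∈ 𝒲 ∧ c ∈ 𝒱) ≤ triT τ (fun a b _ => (a, b) ∈ 𝒳 ∧ a ∈ 𝒱) := by
    have hA : ∀ b : Set ι, IsUpperSet {a : Set ι | (a, b) ∈ 𝒳 ∧ a ∈ 𝒲} := fun b a a' hle ha =>
      ⟨h𝒳 (Prod.mk_le_mk.2 ⟨hle, le_rfl⟩) ha.1, h𝒲 hle ha.2⟩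
    have h := triT_col_le τ (fun b => {a : Set ι | (a, b) ∈ 𝒳 ∧ a ∈ 𝒲}) hA h𝒱
    refine le_trans (le_of_eq (triT_congr fun a b c => ?_)) (le_trans h (le_of_eq (triT_congr fun a b c => ?_)))
    · simp only [Set.mem_setOf_eq]; tauto
    · simp only [Set.mem_setOf_eq]
      exact ⟨fun h => ⟨h.1.1, h.2⟩, fun h => ⟨⟨h.1, hsub h.2⟩, h.2⟩⟩
  -- Theorem U: `X(c∈𝒱, b∉𝒲) ≤ X(a∈𝒱, c∉𝒲)`
  have hU := triT_thmU_le τ h𝒳 h𝒱 h𝒲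
  -- rewrite the Theorem-U counts in the shape produced by the splittings
  have eN : triT τ (fun a b c => ((a, b) ∈ 𝒳 ∧ c ∈ 𝒱) ∧ ¬ b ∈ 𝒲) =
      triT τ (fun a b c => (a, b) ∈ 𝒳 ∧ c ∈ 𝒱 ∧ b ∉ 𝒲) :=
    triT_congr fun a b c => by simp only [and_assoc]
  have eP : triT τ (fun a b c => ((a, b) ∈ 𝒳 ∧ a ∈ 𝒱) ∧ ¬ c ∈ 𝒲) =
      triT τ (fun a b c => (a, b) ∈ 𝒳 ∧ a ∈ 𝒱 ∧ c ∉ 𝒲) :=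
    triT_congr fun a b c => by simp only [and_assoc]
  have e4 : triT τ (fun a b c => ((a, b) ∈ 𝒳 ∧ a ∈ 𝒱) ∧ c ∈ 𝒲) =
      triT τ (fun a b c => (a, b) ∈ 𝒳 ∧ a ∈ 𝒱 ∧ c ∈ 𝒲) :=
    triT_congr fun a b c => by simp only [and_assoc]
  have e2 : triT τ (fun a b c => ((a, b) ∈ 𝒳 ∧ c ∈ 𝒱) ∧ b ∈ 𝒲) =
      triT τ (fun a b c => (a, b) ∈ 𝒳 ∧ c ∈ 𝒱 ∧ b ∈ 𝒲) :=
    triT_congr fun a b c => by simp only [and_assoc]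
  rw [eP, e4] at s1
  rw [eN, e2] at s5
  unfold vSumT
  rw [e1, e5]
  push_cast
  have h3' := (Int.ofNat_le.2 h3)
  have hU' := (Int.ofNat_le.2 hU)
  have s1' := congrArg (fun n : ℕ => (n : ℤ)) s1
  have s5' := congrArg (fun n : ℕ => (n : ℤ)) s5
  simp only [Nat.cast_add] at h3' hU' s1' s5'
  linarith

/-! ## Consequences for the three-partition functional -/

/-- **Twisted three-partition positivity for a nested pair in slots 2, 3**: `threePartNT τ 𝒰 𝒱 𝒲 ≥ 0` whenever
`𝒱 ⊆ 𝒲` (test Conjecture V on the cylinder `{a ∈ 𝒰}`). [this work] -/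
theorem threePartNT_nonneg_of_subset (τ : Set ι) {𝒰 𝒱 𝒲 : Set (Set ι)} (h𝒰 : IsUpperSet 𝒰) (h𝒱 : IsUpperSet 𝒱)
    (h𝒲 : IsUpperSet 𝒲) (hsub : 𝒱 ⊆ 𝒲) : 0 ≤ threePartNT τ 𝒰 𝒱 𝒲 := by
  rw [← vSumT_fst_eq_threePartNT]
  exact vSumT_nonneg_of_subset τ h𝒱 h𝒲 (isUpperSet_fst_mem h𝒰) hsub

/-- `threePartNT` is symmetric in its last two arguments. [this work] -/
theorem threePartNT_swap23 (τ : Set ι) (𝒰 𝒱 𝒲 : Set (Set ι)) : threePartNT τ 𝒰 𝒱 𝒲 = threePartNT τ 𝒰 𝒲 𝒱 := by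
  unfold threePartNT
  have ht : teeT τ 𝒰 𝒱 𝒲 = teeT τ 𝒰 𝒲 𝒱 := by
    unfold teeT; rw [triT_swap23]; exact triT_congr fun a b c => by tauto
  have hi : 𝒰 ∩ 𝒱 ∩ 𝒲 = 𝒰 ∩ 𝒲 ∩ 𝒱 := by
    rw [Set.inter_assoc, Set.inter_comm 𝒱 𝒲, ← Set.inter_assoc]
  rw [ht, hi, Set.inter_comm 𝒱 𝒲]
  push_cast
  ring

/-- `threePartNT` is symmetric in its first two arguments. [this work] -/
theorem threePartNT_swap12 (τ : Set ι) (𝒰 𝒱 𝒲 : Set (Set ι)) : threePartNT τ 𝒰 𝒱 𝒲 = threePartNT τ 𝒱 𝒰 𝒲 := by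
  unfold threePartNT
  have ht : teeT τ 𝒰 𝒱 𝒲 = teeT τ 𝒱 𝒰 𝒲 := by
    unfold teeT; rw [triT_swap12]; exact triT_congr fun a b c => by tauto
  rw [ht, Set.inter_comm 𝒰 𝒱]
  push_cast
  ring

/-- **Twisted three-partition positivity on every triple with a nested pair**: if two of the three up-sets are
nested (in either direction, in any two slots) then `threePartNT τ 𝒰 𝒱 𝒲 ≥ 0`. [this work] -/
theorem threePartNT_nonneg_of_nested (τ : Set ι) {𝒰 𝒱 𝒲 : Set (Set ι)} (h𝒰 : IsUpperSet 𝒰) (h𝒱 : IsUpperSet 𝒱)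
    (h𝒲 : IsUpperSet 𝒲) (h : 𝒱 ⊆ 𝒲 ∨ 𝒲 ⊆ 𝒱 ∨ 𝒰 ⊆ 𝒲 ∨ 𝒲 ⊆ 𝒰 ∨ 𝒰 ⊆ 𝒱 ∨ 𝒱 ⊆ 𝒰) :
    0 ≤ threePartNT τ 𝒰 𝒱 𝒲 := by
  rcases h with h | h | h | h | h | h
  · exact threePartNT_nonneg_of_subset τ h𝒰 h𝒱 h𝒲 h
  · rw [threePartNT_swap23]; exact threePartNT_nonneg_of_subset τ h𝒰 h𝒲 h𝒱 h
  · rw [threePartNT_swap12]; exact threePartNT_nonneg_of_subset τ h𝒱 h𝒰 h𝒲 h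
  · rw [threePartNT_swap12, threePartNT_swap23]; exact threePartNT_nonneg_of_subset τ h𝒱 h𝒲 h𝒰 h
  · rw [threePartNT_swap23, threePartNT_swap12]; exact threePartNT_nonneg_of_subset τ h𝒲 h𝒰 h𝒱 h
  · rw [threePartNT_swap23, threePartNT_swap12, threePartNT_swap23]
    exact threePartNT_nonneg_of_subset τ h𝒲 h𝒱 h𝒰 h

/-- Untwisted corollary: `threePartN 𝒰 𝒱 𝒲 ≥ 0` on every triple of up-sets with a nested pair. [this work] -/
theorem threePartN_nonneg_of_nested {𝒰 𝒱 𝒲 : Set (Set ι)} (h𝒰 : IsUpperSet 𝒰) (h𝒱 : IsUpperSet 𝒱)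
    (h𝒲 : IsUpperSet 𝒲) (h : 𝒱 ⊆ 𝒲 ∨ 𝒲 ⊆ 𝒱 ∨ 𝒰 ⊆ 𝒲 ∨ 𝒲 ⊆ 𝒰 ∨ 𝒰 ⊆ 𝒱 ∨ 𝒱 ⊆ 𝒰) :
    0 ≤ threePartN 𝒰 𝒱 𝒲 := by
  rw [← threePartNT_empty]
  exact threePartNT_nonneg_of_nested ∅ h𝒰 h𝒱 h𝒲 h

end Summit.CriticalPhenomena.PercolationContinuityZ3.Theorems.ThreePartition
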